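import Summits.PneNP.PneNP.Theorems.OneSliceConstantBandAdvSparseGlue
import Summits.PneNP.PneNP.Theorems.OneSliceConstantBandRelMintermStep
import Summits.PneNP.PneNP.Theorems.OneSliceConstantBandNearCliqueContiguity

/-!
# Route OneSlice, crux `ConstantBand` (stmt-PneNP-2834), line `flat-prior-relative-minterms`:
# the registered engine and its advantage form are EQUIVALENT — `RelMintermSparse ↔ AdvSparse`

`OneSliceConstantBandAdvSparseGlue.lean` proves `AdvSparse → RelMintermSparse` (relative-minterm density ≤ planted-detection
advantage, slice by slice, no slack). This file proves the converse

* `fprm_advSparse_of_relMintermSparse : RelMintermSparse → AdvSparse`,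

so that the line's one open registered stub S4 (`stub_relMintermSparse : RelMintermSparse`) and its distinguishing form
`AdvSparse` ("no size-`n^c` monotone circuit is an FPT average-case planted-`k`-clique distinguisher on the critical lower
band") are the SAME statement up to the witnesses (`fprm_relMintermSparse_iff_advSparse`). The proof is the S2 + S3
bookkeeping announced in the glue file's header, now kernel-checked: by the per-slice inequality `rms_perSlice` (S3's key
lemma: inclusion–exclusion + union bound over the `C(k,2)` maximal sub-plantings + monotonicity), the complement rules on a
non-degenerate slice, and near-clique contiguity `stub_nearCliqueContiguity` (S2, landed), for a monotone `f` and every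
lower-band slice `i`

  `P_i[f(x ∪ K_A)=1] − P_i[f=1] ≤ pairProb_i(IsRelMinterm f) + C(k,2)·(P_{i+C(k,2)−1}[f=1] − P_i[f=1] + ε)`;

summed over the lower band the middle differences telescope to `≤ C(k,2) − 1` (flat prior, `rms_sum_Icc_shift_sub_le`), so
`Σ_lower advantage ≤ Σ_lower density + C(k,2)² + C(k,2)·ε·#lower`, and the slack is absorbed by widening: from the witnesses
`(k, ρ, w₁)` of `RelMintermSparse` one gets `AdvSparse` with `(k, ρ + (1/2 − ρ)/2, max w₁ (C(k,2) + ⌈4·C(k,2)²/(1/2 − ρ)⌉₊))`,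
taking `ε := (1/2 − ρ)/(4·C(k,2))` in S2. CONDITIONAL in the sense of D-0014 only through its hypothesis (an open statement of
the line); it closes nothing by itself, it fixes the logical status of the residual stub: S4 ≡ AdvSparse.
-/

set_option linter.dupNamespace false

namespace Summit.PneNP.PneNP.Cruxes.ConstantBand.FlatPriorRelativeMinterms

open Literature.Computability.Complexity Filter Classical
open Finset hiding slice
open Summit.PneNP.PneNP.Theorems.ConstantBand.Negative

/-- **`RelMintermSparse ⟹ AdvSparse`** (S2 + S3 bookkeeping; witnesses `k`, `ρ + (1/2 − ρ)/2`,
`max w₁ (C(k,2) + ⌈4·C(k,2)²/(1/2 − ρ)⌉₊)`). -/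
theorem fprm_advSparse_of_relMintermSparse : RelMintermSparse → AdvSparse := by
  intro h c
  obtain ⟨k, hk, ρ, hρ, w₁, hR⟩ := h c
  have hK3 : 3 ≤ k.choose 2 := le_trans (by decide) (Nat.choose_le_choose 2 hk)
  have hKpos : (0 : ℝ) < k.choose 2 := by exact_mod_cast (show 0 < k.choose 2 by omega)
  have hθ : 0 < 1 / 2 - ρ := by linarith
  have hε : 0 < (1 / 2 - ρ) / (4 * k.choose 2) := by positivity
  refine ⟨k, hk, ρ + (1 / 2 - ρ) / 2, by linarith,
    max w₁ (k.choose 2 + ⌈4 * (k.choose 2 : ℝ) ^ 2 / (1 / 2 - ρ)⌉₊), fun w hw => ?_⟩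
  have hw₁ : w₁ ≤ w := le_trans (le_max_left _ _) hw
  have hwK : k.choose 2 + ⌈4 * (k.choose 2 : ℝ) ^ 2 / (1 / 2 - ρ)⌉₊ ≤ w := le_trans (le_max_right _ _) hw
  filter_upwards [hR w hw₁, stub_nearCliqueContiguity k hk w _ hε, ts_eventually_window k hk w,
    eventually_ge_atTop k] with n hRn hNCC hWn hkn
  intro j hj C hC hs
  have hk2 : 2 ≤ k := by omega
  have hf : Monotone C.eval := C.monotone_eval_of_isOver_monotoneBasis hC
  have hCk : (0 : ℝ) < n.choose k := by exact_mod_cast Nat.choose_pos hkn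
  obtain ⟨_, hWj⟩ := hWn
  obtain ⟨_, hWi⟩ := hWj j hj
  have hIdef : lowerBand k j w = Icc (j - w) (j + w - k.choose 2) := rfl
  -- every lower slice is non-empty, so the complement rules apply there
  have hslice : ∀ i ∈ lowerBand k j w, (#(slice n i) : ℝ) ≠ 0 := by
    intro i hi
    rw [hIdef, mem_Icc] at hi
    have hi' : i ≤ j + w := by omega
    have hpos := ts_card_slice_pos (n := n) (hWi i hi').1
    have : (0 : ℝ) < #(slice n i) := by exact_mod_cast hpos
    exact this.ne'
  -- per slice: advantage ≤ density + K·(P_{i+K-1}[f=1] + ε − P_i[f=1])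
  have hper : ∀ i ∈ lowerBand k j w,
      pairProb n k i (fun x A => C.eval (plantClique A x) = true) - sliceProb n i (fun x => C.eval x = true) ≤
        pairProb n k i (IsRelMinterm C.eval) +
          (k.choose 2 : ℝ) * (sliceProb n (i + (k.choose 2 - 1)) (fun x => C.eval x = true) +
            (1 / 2 - ρ) / (4 * k.choose 2) - sliceProb n i (fun x => C.eval x = true)) := by
    intro i hi
    have hcont := hNCC j hj i (rms_lowerBand_subset k j w hi) (univ.filter fun y => C.eval y = true)
    have e1 : tripleProb n k i (fun x A e => C.eval (plantSub A e x) = true) =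
        tripleProb n k i (fun x A e => plantSub A e x ∈ univ.filter fun y => C.eval y = true) :=
      rms_tripleProb_congr fun x A e => by simp
    have e2 : sliceProb n (i + k.choose 2 - 1) (fun y => y ∈ univ.filter fun y => C.eval y = true) =
        sliceProb n (i + (k.choose 2 - 1)) (fun x => C.eval x = true) := by
      rw [show i + k.choose 2 - 1 = i + (k.choose 2 - 1) by omega]
      exact rms_sliceProb_congr fun x => by simp
    rw [← e1, e2] at hcont
    have hps := rms_perSlice (i := i) hkn hk2 hf
    have hmul : (k.choose 2 : ℝ) * (tripleProb n k i (fun x A e => C.eval (plantSub A e x) = true) -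
        sliceProb n i (fun x => C.eval x = true)) ≤
        (k.choose 2 : ℝ) * (sliceProb n (i + (k.choose 2 - 1)) (fun x => C.eval x = true) +
          (1 / 2 - ρ) / (4 * k.choose 2) - sliceProb n i (fun x => C.eval x = true)) :=
      mul_le_mul_of_nonneg_left (by linarith) hKpos.le
    have h1 := fprm_sliceProb_false_add_true i C.eval (hslice i hi)
    have h2 := fprm_pairProb_false_add_true k i C.eval (mul_ne_zero (hslice i hi) hCk.ne')
    linarith
  -- flat prior
  have htel : ∑ i ∈ lowerBand k j w, (sliceProb n (i + (k.choose 2 - 1)) (fun x => C.eval x = true) -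
      sliceProb n i (fun x => C.eval x = true)) ≤ (k.choose 2 : ℝ) - 1 := by
    have h := rms_sum_Icc_shift_sub_le (fun i => sliceProb n i (fun x => C.eval x = true))
      (fun t => div_nonneg (Nat.cast_nonneg _) (Nat.cast_nonneg _))
      (fun t => rms_sliceProb_le_one _ _ _) (j - w) (j + w - k.choose 2) (k.choose 2 - 1)
    rw [Nat.cast_sub (by omega), Nat.cast_one] at h
    exact h
  -- sum of the per-slice bounds
  have hsum : ∑ i ∈ lowerBand k j w, (pairProb n k i (fun x A => C.eval (plantClique A x) = true) -
      sliceProb n i (fun x => C.eval x = true)) ≤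
      ∑ i ∈ lowerBand k j w, pairProb n k i (IsRelMinterm C.eval) +
        (k.choose 2 : ℝ) * (∑ i ∈ lowerBand k j w, (sliceProb n (i + (k.choose 2 - 1)) (fun x => C.eval x = true) -
          sliceProb n i (fun x => C.eval x = true)) + (1 / 2 - ρ) / (4 * k.choose 2) * #(lowerBand k j w)) := by
    calc ∑ i ∈ lowerBand k j w, (pairProb n k i (fun x A => C.eval (plantClique A x) = true) -
          sliceProb n i (fun x => C.eval x = true))
        ≤ ∑ i ∈ lowerBand k j w, (pairProb n k i (IsRelMinterm C.eval) +
            (k.choose 2 : ℝ) * (sliceProb n (i + (k.choose 2 - 1)) (fun x => C.eval x = true) +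
              (1 / 2 - ρ) / (4 * k.choose 2) - sliceProb n i (fun x => C.eval x = true))) := sum_le_sum hper
      _ = _ := by
          have hsplit : ∑ i ∈ lowerBand k j w, (sliceProb n (i + (k.choose 2 - 1)) (fun x => C.eval x = true) +
              (1 / 2 - ρ) / (4 * k.choose 2) - sliceProb n i (fun x => C.eval x = true)) =
              ∑ i ∈ lowerBand k j w, (sliceProb n (i + (k.choose 2 - 1)) (fun x => C.eval x = true) -
                sliceProb n i (fun x => C.eval x = true)) + (1 / 2 - ρ) / (4 * k.choose 2) * #(lowerBand k j w) :=
            calc ∑ i ∈ lowerBand k j w, (sliceProb n (i + (k.choose 2 - 1)) (fun x => C.eval x = true) +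
                  (1 / 2 - ρ) / (4 * k.choose 2) - sliceProb n i (fun x => C.eval x = true))
                = ∑ i ∈ lowerBand k j w, ((sliceProb n (i + (k.choose 2 - 1)) (fun x => C.eval x = true) -
                    sliceProb n i (fun x => C.eval x = true)) + (1 / 2 - ρ) / (4 * k.choose 2)) :=
                  sum_congr rfl fun i _ => by ring
              _ = ∑ i ∈ lowerBand k j w, (sliceProb n (i + (k.choose 2 - 1)) (fun x => C.eval x = true) -
                    sliceProb n i (fun x => C.eval x = true)) +
                    ∑ _i ∈ lowerBand k j w, (1 / 2 - ρ) / (4 * k.choose 2) := sum_add_distrib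
              _ = _ := by rw [sum_const, nsmul_eq_mul, mul_comm]
          rw [sum_add_distrib, ← mul_sum, hsplit]
  -- the engine bound on the density
  have hdens := hRn j hj C hC hs
  -- sizes
  have hcardI : (w : ℝ) + 1 - k.choose 2 ≤ #(lowerBand k j w) := by
    have h := rms_card_Icc_lower_ge (k.choose 2) j w
    rw [← hIdef] at h
    have hwK' : k.choose 2 ≤ w + 1 := by omega
    have h' : ((w + 1 - k.choose 2 : ℕ) : ℝ) ≤ #(lowerBand k j w) := by exact_mod_cast h
    rw [Nat.cast_sub hwK', Nat.cast_add, Nat.cast_one] at h'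
    exact h'
  have hceil : 4 * (k.choose 2 : ℝ) ^ 2 / (1 / 2 - ρ) ≤ (⌈4 * (k.choose 2 : ℝ) ^ 2 / (1 / 2 - ρ)⌉₊ : ℝ) :=
    Nat.le_ceil _
  have hwge : (k.choose 2 : ℝ) + (⌈4 * (k.choose 2 : ℝ) ^ 2 / (1 / 2 - ρ)⌉₊ : ℝ) ≤ w := by exact_mod_cast hwK
  have hI_big : 4 * (k.choose 2 : ℝ) ^ 2 / (1 / 2 - ρ) ≤ #(lowerBand k j w) := by linarith
  have hKK : (k.choose 2 : ℝ) * ((k.choose 2 : ℝ) - 1) ≤ (1 / 2 - ρ) / 4 * #(lowerBand k j w) := by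
    have h5 : 4 * (k.choose 2 : ℝ) ^ 2 ≤ #(lowerBand k j w) * (1 / 2 - ρ) := (div_le_iff₀ hθ).1 hI_big
    nlinarith [hKpos]
  have hKε : (k.choose 2 : ℝ) * ((1 / 2 - ρ) / (4 * k.choose 2) * #(lowerBand k j w)) =
      (1 / 2 - ρ) / 4 * #(lowerBand k j w) := by
    field_simp
  -- assemble
  have hmid : (k.choose 2 : ℝ) * (∑ i ∈ lowerBand k j w, (sliceProb n (i + (k.choose 2 - 1)) (fun x => C.eval x = true) -
      sliceProb n i (fun x => C.eval x = true)) + (1 / 2 - ρ) / (4 * k.choose 2) * #(lowerBand k j w)) ≤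
      (1 / 2 - ρ) / 4 * #(lowerBand k j w) + (1 / 2 - ρ) / 4 * #(lowerBand k j w) := by
    rw [mul_add, hKε]
    have : (k.choose 2 : ℝ) * ∑ i ∈ lowerBand k j w, (sliceProb n (i + (k.choose 2 - 1)) (fun x => C.eval x = true) -
        sliceProb n i (fun x => C.eval x = true)) ≤ (k.choose 2 : ℝ) * ((k.choose 2 : ℝ) - 1) :=
      mul_le_mul_of_nonneg_left htel hKpos.le
    linarith
  calc ∑ i ∈ lowerBand k j w, (pairProb n k i (fun x A => C.eval (plantClique A x) = true) -
        sliceProb n i (fun x => C.eval x = true))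
      ≤ ∑ i ∈ lowerBand k j w, pairProb n k i (IsRelMinterm C.eval) +
          (k.choose 2 : ℝ) * (∑ i ∈ lowerBand k j w, (sliceProb n (i + (k.choose 2 - 1)) (fun x => C.eval x = true) -
            sliceProb n i (fun x => C.eval x = true)) + (1 / 2 - ρ) / (4 * k.choose 2) * #(lowerBand k j w)) := hsum
    _ ≤ ρ * #(lowerBand k j w) + ((1 / 2 - ρ) / 4 * #(lowerBand k j w) + (1 / 2 - ρ) / 4 * #(lowerBand k j w)) :=
          add_le_add hdens hmid
    _ = (ρ + (1 / 2 - ρ) / 2) * #(lowerBand k j w) := by ring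

/-- **S4 ≡ its advantage form**: `RelMintermSparse ↔ AdvSparse` (this file + `fprm_relMintermSparse_of_advSparse`). -/
theorem fprm_relMintermSparse_iff_advSparse : RelMintermSparse ↔ AdvSparse :=
  ⟨fprm_advSparse_of_relMintermSparse, fprm_relMintermSparse_of_advSparse⟩

end Summit.PneNP.PneNP.Cruxes.ConstantBand.FlatPriorRelativeMinterms
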